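import Summits.QuantumFields.YangMills.Theorems.BalabanUVNodesN09RegularityTowerAxialLetter
import Summits.QuantumFields.YangMills.Theorems.BalabanUVNodesN09RegularityTowerSelOfThm1OfNumerics

/-!
# NODE N09 [B12] · THE AXIAL LETTER's TOWER: ITS NUMERICS ARE JOINTLY INHABITED (non-vacuity), AND THE α-FREE EDITION IN ROAD A′'s CURRENCY

Cell `pub-ymgap` (YM-PLAN Track A), DAG node N09 [Balaban1987RG1] (= [I]); width seat `pub-ymgap-dag-n09-w5` g7, FILE 4 (sequel of `…N09RegularityTowerAxialLetter`, p646231); count-neutral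
helper keyed to K1⁹ `StabilityBRunRowsAtRecordR13SepCoPHV` = stmt-QuantumFields-27364 (`--kind proof --supports … --as helper`).

WHY.  FILE 3's `exists_axialLetter_tower_of_thm1_εbg_of_reg8` displays, besides [B11] Thm 1's two-radii binders `h11 hreg8`, twenty-odd numerics letters in `(εreg, εbg, α₀, ε₁, δ, α,
ε₀; d, L, N)`.  Two bookkeeping duties remain, both already done for the OFFER by dag-n09-w2 g5 (`…N09RegularityTowerSelOfThm1OfNumerics` §2–§3) and owed for the axial edition so that
the two editions stand on the same footing: (§1) NON-VACUITY — the letters are JOINTLY INHABITED for every torus family, `N ≥ 1`, torus `K` (dag-n09-w2's `towerSel_numerics_inhabited`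
at the Prop-2 radius `δ := 2εreg∕L²`, where `2εreg ≤ δL²` holds with equality), so for SOME numerics the ONLY displayed inputs left are `h11` ∕ `hreg8`; (§2) the α-FREE EDITION in road
A′'s currency (dag-n09-w4 g6): at `α := (((d+2)L)²∕4)·ε₀` the four loop-guard letters are theorems of the three `ε₀`-lines `h24 h64 hL` and of the strict `hord`.

WHAT IS PROVED (theorems only; 0 `def`, 0 `instance`, 0 `sorry`; axioms standard).
* §1 ★★ `exists_numerics_axialLetter_tower_of_thm1` — `∃ ν εbg ε₁ δ` (integer ∕ profile slots of `ν` prescribed) with `0 < εreg < εbg`, `0 < ε₀`, `0 < ε₁`, `0 < δ` and: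
  `h11 → hreg8 →` FILE 3 §2's full conclusion (`∃ crit χ`, axial extras, the six clauses, and at every history the tower's three outputs).
* §2 ★★ `exists_axialLetter_tower_of_thm1_εbg_of_reg8_alphaFree` — FILE 3 §2 with `hα24 hαδ hαL hαB` replaced by `h24 h64 hL` (and `0 ≤ ε₀`): displayed = `h11 hreg8` + numerics in
  `(εreg, εbg, α₀, ε₁, δ, ε₀; d, L, N)` only.

HONEST SCOPE ∕ FRAMING.  Count-neutral bookkeeping BY NAME (FILE 3 + dag-n09-w2's inhabitedness theorem); §1 is NON-VACUITY by SOME numerics, NOT the record's numerics row (the K0-numerics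
lane's knit); [B11] Thm 1 ONLY as displayed hypotheses; NOTHING of Bałaban's asserted; the axial letter is an ∃-witness no record reads; `hreg`∕(F3) AT THE RECORD NOT discharged; N09 NOT
discharged; conjunct 1 (Lemma 4) ∕ FLAG №7 untouched; K0⁷ ∕ K1⁹ ∕ K3⁸ NOT closed; counts unmoved (typed 28∕28 · discharged 5∕28); one finite four-torus programme at fixed `ε = L^{−K}` per
run — R4 closes the conditional rung `BalabanLadder.UV` only; NOT ℝ⁴ ∕ infinite volume ∕ OS; the Yang–Mills mass gap (Clay) is NOT proved by any of this.
-/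

noncomputable section

open Set Filter Topology MeasureTheory

namespace Summit.QuantumFields.YangMills.BalabanUVNodes.N09RegularityTowerAxialLetterNumerics

open Literature.MathematicalPhysics.QuantumFieldTheory.Balaban1983to89
open Literature.MathematicalPhysics.QuantumFieldTheory.Balaban1983to89.Node00
open Literature.MathematicalPhysics.QuantumFieldTheory.Balaban1983to89.T4Continuum (T4Family)
open Literature.MathematicalPhysics.QuantumFieldTheory.Balaban1983to89.ExpMeanLog (deltaSU)
open Literature.MathematicalPhysics.QuantumFieldTheory.Balaban1983to89.FederbushMean (deltaFed)
open B12RTGaugeInvariance254 (liftTransf)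
open GaugeField (gaugeAct)
open Summit.QuantumFields.YangMills.BalabanUVNodes.N09RegularityTowerAxialLetter (exists_axialLetter_tower_of_thm1_εbg_of_reg8)
open Summit.QuantumFields.YangMills.BalabanUVNodes.N09RegularityTowerSelOfThm1OfNumerics (towerSel_numerics_inhabited)

variable {F : T4Family} {N : ℕ} [NeZero N]

/-! ## §1. Non-vacuity: for SOME numerics the only displayed inputs of the axial tower are [B11]'s two-radii binders -/

/-- ★★ **THE AXIAL TOWER IS NOT VACUOUS IN ITS NUMERICS**: for every torus family, `N ≥ 1`, torus `K` and any integer ∕ profile slots there ARE numerics `ν`, a background radius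
`εbg`, a threshold `ε₁` and a Prop-2 radius `δ` (all positive, `εreg < εbg`) for which [B11] Thm 1's two-radii binders `h11` ∕ `hreg8` on the domains ALONE yield FILE 3 §2's whole
conclusion — the axial letter with its cut-off, the six clauses, and road B's three outputs at every history.  Witness: dag-n09-w2's `towerSel_numerics_inhabited` at `δ := 2εreg∕L²`.
[cite: Balaban1987RG1, (2.3) p.265, p.259, (0.19) p.255 and (2.10) p.267; Balaban1985Variational, Thm 1 (8) p.279] -/
theorem exists_numerics_axialLetter_tower_of_thm1 (F : T4Family) (N : ℕ) [NeZero N] (K M₁ M₂ r p₀ : ℕ) (A₀ logσ₀ : ℝ) :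
    ∃ (ν : Stage7Numerics) (εbg ε₁ δ : ℝ), ν.M₁ = M₁ ∧ ν.M₂ = M₂ ∧ ν.r = r ∧ ν.p₀ = p₀ ∧ ν.A₀ = A₀ ∧ ν.logσ₀ = logσ₀ ∧
      0 < ν.εreg ∧ ν.εreg < εbg ∧ 0 < ν.ε₀ ∧ 0 < ε₁ ∧ 0 < δ ∧
      ((∀ k, k ≤ K → ∀ V ∈ domAltOfRecord F N ν K k, UkExists F N K k εbg V ∧ UniqueUkOrbit F N K k εbg V) →
        (∀ k, k ≤ K → ∀ V ∈ domAltOfRecord F N ν K k, Uk F N K k εbg V ∈ bgReg F N K k ν.εreg) →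
        ∃ (crit : (K j : ℕ) → GaugeField (F.P K) (j + 1) (SU N) → GaugeField (F.P K) j (SU N))
          (χ : (K : ℕ) → (ℕ → ℝ) → (k : ℕ) → Density (F.P K) k (SU N)),
          (∀ j < K, Measurable (crit K j)) ∧
          (∀ j < K, ∀ W, AxialGauge (contourOfRecord F N K j) (crit K j W)) ∧
          (∀ j < K, ∀ (v : GaugeTransf (F.P K) (j + 1) (SU N)) (W : GaugeField (F.P K) (j + 1) (SU N)),
            UkExists F N K (j + 1) ν.εreg W → UniqueUkOrbit F N K (j + 1) ν.εreg W → crit K j (gaugeAct v W) = gaugeAct (liftTransf v) (crit K j W)) ∧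
          (∀ (g : ℕ → ℝ) (j : ℕ), Measurable (χ K g j)) ∧
          (∀ (g : ℕ → ℝ) (j : ℕ) (U : GaugeField (F.P K) j (SU N)), χ K g j U = 0 ∨ χ K g j U = 1) ∧
          (∀ (g : ℕ → ℝ), ∀ j < K, ∀ V : GaugeField (F.P K) j (SU N),
            χ K g j V = 1 ↔ ∀ b : PBond (F.P K) j, ¬ IsB0 b → dist1 ((crit K j ((avOfRecord F N K j).avg V) b)⁻¹ * V b) < ε₁) ∧
          (∀ j < K, ∀ W ∈ domAltOfRecord F N ν K (j + 1), (avOfRecord F N K j).avg (crit K j W) = W) ∧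
          (∀ j < K, ∀ W ∈ domAltOfRecord F N ν K (j + 1), PlaqSmall δ (crit K j W)) ∧
          (∀ j < K, ContinuousOn (crit K j) (domAltOfRecord F N ν K (j + 1))) ∧
          ∀ g : ℕ → ℝ,
            (∀ j, j ≤ K → ContinuousOn (effActionHT F N (TcanOfRecord F N) χ K g j) (domAltOfRecord F N ν K j)) ∧
            (∀ j < K, (domAltOfRecord F N ν K (j + 1) ⊆ regSetOfRecord F N K j (betaInputOfRecord F N (TcanOfRecord F N) χ K g j) ∧
                HasContTransportOn F N K j (betaInputOfRecord F N (TcanOfRecord F N) χ K g j) (domAltOfRecord F N ν K (j + 1))) ∧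
              ∀ V ∈ domAltOfRecord F N ν K (j + 1), 0 < TcanOfRecord F N K j (betaInputOfRecord F N (TcanOfRecord F N) χ K g j) V) ∧
            (0 < ν.ε₀ → ∀ j < K, 0 < normConstHT F N (TcanOfRecord F N) χ K g j ∧
              ∀ V ∈ domAltOfRecord F N ν K (j + 1),
                TcanOfRecord F N K j (betaInputOfRecord F N (TcanOfRecord F N) χ K g j) V
                  = normConstHT F N (TcanOfRecord F N) χ K g j * Real.exp (effActionHT F N (TcanOfRecord F N) χ K g (j + 1) V))) := by
  obtain ⟨ν, εbg, α₀, α, ε₁, h1, h2, h3, h4, h5, h6, hε₀, hε1, hα24, hαδ, hαL, hεreg, hε3, hε2, hn1, hn2, hαB, hord, hlt, he, hα0, hα3, hα2, hα24', hαL', hGFnum⟩ :=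
    towerSel_numerics_inhabited F N K M₁ M₂ r p₀ A₀ logσ₀
  have hL : (0 : ℝ) < (F.P K).L := by exact_mod_cast (F.P K).L_pos
  have hδpos : 0 < 2 * ν.εreg / ((F.P K).L : ℝ) ^ 2 := by positivity
  have hδreg : 2 * ν.εreg ≤ 2 * ν.εreg / ((F.P K).L : ℝ) ^ 2 * ((F.P K).L : ℝ) ^ 2 := by
    rw [div_mul_cancel₀ _ (by positivity)]
  exact ⟨ν, εbg, ε₁, 2 * ν.εreg / ((F.P K).L : ℝ) ^ 2, h1, h2, h3, h4, h5, h6, hεreg, hlt, hε₀, hε1, hδpos, fun h11 hreg8 =>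
    exists_axialLetter_tower_of_thm1_εbg_of_reg8 ν εbg K hlt he hα0 hα3 hα2 hα24' hαL' hεreg hε3 hε2 hδreg h11 hreg8 hε1 hα24 hαδ hαL hn1 hn2 hαB hord
      hε₀.le hGFnum⟩

/-! ## §2. The α-free edition in road A′'s currency -/

/-- ★★ **α-FREE EDITION OF THE AXIAL TOWER** (road A′'s currency, dag-n09-w4 g6 ∕ dag-n09-w2 g5's pattern): the loop-guard radius `α` is not a letter — at `α := (((d+2)L)²∕4)·ε₀` the four
guard letters `hα24 hαδ hαL hαB` of FILE 3 §2 are theorems of the three `ε₀`-lines `h24 h64 hL` and of the strict `hord` (`(ℓ²∕4)·Q < (ℓ²∕4)·ε₀`), so the axial tower displays [B11]'s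
two-radii binders + numerics in `(εreg, εbg, α₀, ε₁, δ, ε₀; d, L, N)` only. [cite: Balaban1987RG1, p.259, (0.19) p.255, (2.3) p.265, (2.9)–(2.10) p.266–267; Balaban1985Variational, Thm 1 (8) p.279] -/
theorem exists_axialLetter_tower_of_thm1_εbg_of_reg8_alphaFree (ν : Stage7Numerics) (εbg : ℝ) (K : ℕ) {α₀ ε₁ δ : ℝ} (hlt : ν.εreg < εbg) (he : ν.εreg < α₀)
    (hα : 0 < α₀) (hα3 : (143 * (((((F.P K).d + 4 : ℕ) : ℝ)) ^ 2 / 4) ^ 2) * α₀ ≤ 1 / 3)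
    (hα2 : 2 * α₀ ≤ 2 * deltaSU (Fin N) / ((((F.P K).d + 4) * (F.P K).L : ℕ) : ℝ) ^ 2)
    (hα024 : ((((F.P K).d + 2) * (F.P K).L : ℕ) : ℝ) ^ 2 / 4 * (2 * α₀) ≤ 1 / 24)
    (hα0L : 157 * (((((F.P K).d + 2) * (F.P K).L : ℕ) : ℝ) ^ 2 / 4 * (2 * α₀)) < (((F.P K).L : ℝ) ^ ((F.P K).d - 1))⁻¹)
    (hε : 0 < ν.εreg) (hε3 : (143 * (((((F.P K).d + 4 : ℕ) : ℝ)) ^ 2 / 4) ^ 2) * ν.εreg ≤ 1 / 3)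
    (hε2 : 2 * ν.εreg ≤ 2 * deltaSU (Fin N) / ((((F.P K).d + 4) * (F.P K).L : ℕ) : ℝ) ^ 2) (hδreg : 2 * ν.εreg ≤ δ * ((F.P K).L : ℝ) ^ 2)
    (h11 : ∀ k, k ≤ K → ∀ V ∈ domAltOfRecord F N ν K k, UkExists F N K k εbg V ∧ UniqueUkOrbit F N K k εbg V)
    (hreg8 : ∀ k, k ≤ K → ∀ V ∈ domAltOfRecord F N ν K k, Uk F N K k εbg V ∈ bgReg F N K k ν.εreg)
    (hε1 : 0 < ε₁)
    (hn1 : 1640 * (2 * (((((F.P K).d + 2) * (F.P K).L : ℕ) : ℝ) * ε₁) + ((((F.P K).d + 2) * (F.P K).L : ℕ) : ℝ) ^ 2 / 4 * δ) *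
      (((F.P K).L : ℝ) ^ ((F.P K).d - 1)) ^ 2 ≤ 1)
    (hn2 : 13 * (2 * (((((F.P K).d + 2) * (F.P K).L : ℕ) : ℝ) * ε₁) + ((((F.P K).d + 2) * (F.P K).L : ℕ) : ℝ) ^ 2 / 4 * δ) *
      ((F.P K).L : ℝ) ^ ((F.P K).d - 1) < deltaSU (Fin N))
    (hord : δ + 4 * max ε₁ (10 * (((((F.P K).d + 2) * (F.P K).L : ℕ) : ℝ) * ε₁) * ((F.P K).L : ℝ) ^ ((F.P K).d - 1)) < ν.ε₀)
    (hε₀ : 0 ≤ ν.ε₀)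
    (h24 : ((((F.P K).d + 2) * (F.P K).L : ℕ) : ℝ) ^ 2 / 4 * ν.ε₀ < 1 / 24)
    (h64 : 64 * (((((F.P K).d + 2) * (F.P K).L : ℕ) : ℝ) ^ 2 / 4 * ν.ε₀) < deltaSU (Fin N))
    (hL : 157 * (((((F.P K).d + 2) * (F.P K).L : ℕ) : ℝ) ^ 2 / 4 * ν.ε₀) < ((((F.P K).L : ℝ)) ^ ((F.P K).d - 1))⁻¹)
    (hGFnum : ((((F.P K).d * (F.P K).L : ℕ) : ℝ)) ^ 2 / 4 * ν.ε₀ < deltaFed (Fin N)) :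
    ∃ (crit : (K j : ℕ) → GaugeField (F.P K) (j + 1) (SU N) → GaugeField (F.P K) j (SU N))
      (χ : (K : ℕ) → (ℕ → ℝ) → (k : ℕ) → Density (F.P K) k (SU N)),
      (∀ j < K, Measurable (crit K j)) ∧
      (∀ j < K, ∀ W, AxialGauge (contourOfRecord F N K j) (crit K j W)) ∧
      (∀ j < K, ∀ (v : GaugeTransf (F.P K) (j + 1) (SU N)) (W : GaugeField (F.P K) (j + 1) (SU N)),
        UkExists F N K (j + 1) ν.εreg W → UniqueUkOrbit F N K (j + 1) ν.εreg W → crit K j (gaugeAct v W) = gaugeAct (liftTransf v) (crit K j W)) ∧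
      (∀ (g : ℕ → ℝ) (j : ℕ), Measurable (χ K g j)) ∧
      (∀ (g : ℕ → ℝ) (j : ℕ) (U : GaugeField (F.P K) j (SU N)), χ K g j U = 0 ∨ χ K g j U = 1) ∧
      (∀ (g : ℕ → ℝ), ∀ j < K, ∀ V : GaugeField (F.P K) j (SU N),
        χ K g j V = 1 ↔ ∀ b : PBond (F.P K) j, ¬ IsB0 b → dist1 ((crit K j ((avOfRecord F N K j).avg V) b)⁻¹ * V b) < ε₁) ∧
      (∀ j < K, ∀ W ∈ domAltOfRecord F N ν K (j + 1), (avOfRecord F N K j).avg (crit K j W) = W) ∧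
      (∀ j < K, ∀ W ∈ domAltOfRecord F N ν K (j + 1), PlaqSmall δ (crit K j W)) ∧
      (∀ j < K, ContinuousOn (crit K j) (domAltOfRecord F N ν K (j + 1))) ∧
      ∀ g : ℕ → ℝ,
        (∀ j, j ≤ K → ContinuousOn (effActionHT F N (TcanOfRecord F N) χ K g j) (domAltOfRecord F N ν K j)) ∧
        (∀ j < K, (domAltOfRecord F N ν K (j + 1) ⊆ regSetOfRecord F N K j (betaInputOfRecord F N (TcanOfRecord F N) χ K g j) ∧
            HasContTransportOn F N K j (betaInputOfRecord F N (TcanOfRecord F N) χ K g j) (domAltOfRecord F N ν K (j + 1))) ∧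
          ∀ V ∈ domAltOfRecord F N ν K (j + 1), 0 < TcanOfRecord F N K j (betaInputOfRecord F N (TcanOfRecord F N) χ K g j) V) ∧
        (0 < ν.ε₀ → ∀ j < K, 0 < normConstHT F N (TcanOfRecord F N) χ K g j ∧
          ∀ V ∈ domAltOfRecord F N ν K (j + 1),
            TcanOfRecord F N K j (betaInputOfRecord F N (TcanOfRecord F N) χ K g j) V
              = normConstHT F N (TcanOfRecord F N) χ K g j * Real.exp (effActionHT F N (TcanOfRecord F N) χ K g (j + 1) V)) := by
  have hℓ : (0 : ℝ) < ((((F.P K).d + 2) * (F.P K).L : ℕ) : ℝ) ^ 2 / 4 :=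
    div_pos (pow_pos (by exact_mod_cast Nat.mul_pos (by omega) (F.P K).L_pos) 2) four_pos
  have hm0 : 0 ≤ ((((F.P K).d + 2) * (F.P K).L : ℕ) : ℝ) ^ 2 / 4 * ν.ε₀ := mul_nonneg hℓ.le hε₀
  exact exists_axialLetter_tower_of_thm1_εbg_of_reg8 ν εbg K (α := ((((F.P K).d + 2) * (F.P K).L : ℕ) : ℝ) ^ 2 / 4 * ν.ε₀) hlt he hα hα3 hα2 hα024 hα0L hε hε3 hε2
    hδreg h11 hreg8 hε1 h24.le (by linarith) hL hn1 hn2 (mul_lt_mul_of_pos_left hord hℓ) hord hε₀ hGFnum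

end Summit.QuantumFields.YangMills.BalabanUVNodes.N09RegularityTowerAxialLetterNumerics
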